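import Literature.NumberTheory.Sieve.SmoothMajorantZeta
import Mathlib.NumberTheory.EulerProduct.DirichletLSeries
import Mathlib.NumberTheory.ZetaValues
import Mathlib.Analysis.Real.Pi.Bounds
import HarnessLib

/-!
# Local input for the smooth linear forms estimate (Conlon–Fox–Zhao §9): Euler-product bounds near `1`

Trunk T-SIEVE. D. Conlon, J. Fox, Y. Zhao, *The Green–Tao theorem: an exposition*
(arXiv:1403.2957), §9, p. 18, the bound used for the error terms ("Error estimates: Estimate (32)"):
"`∑_{1≤d≤R} d^{-1-1/log R} ≤ ∏_{p}(1 - p^{-1-1/log R})^{-1} = ζ(1 + 1/log R) = O(log R)`".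
This file proves the finite, real-variable versions: partial Euler products of `ζ(σ)` (`σ > 1`
real) are bounded by `|ζ(σ)| ≤ 1/(σ-1) + C`, hence `∏_{p<n}(1 + k p^{-σ}) ≤ (1/(σ-1) + C)^k`, and
`∏_{p<n}(1 + K/p²) ≤ exp(2K)`.

## References
* D. Conlon, J. Fox, Y. Zhao, EMS Surv. Math. Sci. 1 (2014), 249–282, §9 (p. 18, "Estimate (32)").
  [cite: ConlonFoxZhao2014]
-/

noncomputable section

open Filter Topology Finset

namespace Literature.NumberTheory.Sieve.CFZ

/-- The real partial Euler products of `ζ(σ)`, `σ > 1`, are bounded by `|ζ(σ)|`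
(`riemannZeta_eulerProduct` and monotone convergence). [cite: ConlonFoxZhao2014, Section 9] -/
theorem prod_primesBelow_le_norm_zeta {σ : ℝ} (hσ : 1 < σ) (n : ℕ) :
    ∏ p ∈ n.primesBelow, (1 - (p : ℝ) ^ (-σ))⁻¹ ≤ ‖riemannZeta σ‖ := by
  -- the real factors
  have hfac : ∀ p : ℕ, p.Prime → 0 < (p : ℝ) ^ (-σ) ∧ (p : ℝ) ^ (-σ) < 1 := fun p hp => by
    have hp1 : (1 : ℝ) < p := by exact_mod_cast hp.one_lt
    exact ⟨Real.rpow_pos_of_pos (by linarith) _,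
      Real.rpow_lt_one_of_one_lt_of_neg hp1 (by linarith)⟩
  have hone : ∀ p : ℕ, p.Prime → (1 : ℝ) ≤ (1 - (p : ℝ) ^ (-σ))⁻¹ := fun p hp => by
    obtain ⟨h0, h1⟩ := hfac p hp
    rw [le_inv_comm₀ zero_lt_one (by linarith), inv_one]; linarith
  -- identification with the norms of the complex partial products
  have hnorm : ∀ n : ℕ, ‖∏ p ∈ n.primesBelow, (1 - (p : ℂ) ^ (-(σ : ℂ)))⁻¹‖ =
      ∏ p ∈ n.primesBelow, (1 - (p : ℝ) ^ (-σ))⁻¹ := by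
    intro n
    rw [norm_prod]
    refine prod_congr rfl fun p hp => ?_
    have hpP := (Nat.mem_primesBelow.1 hp).2
    obtain ⟨h0, h1⟩ := hfac p hpP
    have hc : (p : ℂ) ^ (-(σ : ℂ)) = (((p : ℝ) ^ (-σ) : ℝ) : ℂ) := by
      rw [Complex.ofReal_cpow (by positivity), Complex.ofReal_neg, Complex.ofReal_natCast]
    rw [hc, ← Complex.ofReal_one, ← Complex.ofReal_sub, ← Complex.ofReal_inv, Complex.norm_real,
      Real.norm_eq_abs, abs_of_pos (inv_pos.2 (by linarith))]
  have hσ' : 1 < (σ : ℂ).re := by simpa using hσ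
  have htend : Tendsto (fun n : ℕ => ∏ p ∈ n.primesBelow, (1 - (p : ℝ) ^ (-σ))⁻¹) atTop (𝓝 ‖riemannZeta σ‖) := by
    have h := (riemannZeta_eulerProduct hσ').norm
    exact h.congr fun n => hnorm n
  have hmono : Monotone fun n : ℕ => ∏ p ∈ n.primesBelow, (1 - (p : ℝ) ^ (-σ))⁻¹ := by
    intro a b hab
    exact prod_le_prod_of_subset_of_one_le (Nat.primesBelow_mono hab)
      (fun p hp => (zero_le_one.trans (hone p (Nat.mem_primesBelow.1 hp).2)))
      fun p hp _ => hone p (Nat.mem_primesBelow.1 hp).2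
  exact hmono.ge_of_tendsto htend n

/-- `|ζ(σ)| ≤ 1/(σ-1) + C` for `1 < σ ≤ 2` (from `exists_bound_riemannZeta_sub_one_div`).
[cite: ConlonFoxZhao2014, Section 9] -/
theorem exists_norm_zeta_real_le : ∃ C : ℝ, 0 ≤ C ∧ ∀ σ : ℝ, 1 < σ → σ ≤ 2 →
    ‖riemannZeta σ‖ ≤ 1 / (σ - 1) + C := by
  obtain ⟨C, hC⟩ := exists_bound_riemannZeta_sub_one_div
  refine ⟨max C 0, le_max_right _ _, fun σ h1 h2 => ?_⟩
  have hne : (σ : ℂ) ≠ 1 := by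
    intro h; have := congrArg Complex.re h; simp at this; linarith
  have hn : ‖(σ : ℂ) - 1‖ ≤ 1 := by
    rw [← Complex.ofReal_one, ← Complex.ofReal_sub, Complex.norm_real, Real.norm_eq_abs, abs_of_pos (by linarith)]
    linarith
  have h := hC σ hne hn
  have hinv : ‖(1 : ℂ) / ((σ : ℂ) - 1)‖ = 1 / (σ - 1) := by
    rw [← Complex.ofReal_one, ← Complex.ofReal_sub, ← Complex.ofReal_div, Complex.norm_real,
      Real.norm_eq_abs, abs_of_pos (by rw [one_div]; exact inv_pos.2 (by linarith))]
  calc ‖riemannZeta σ‖ = ‖(riemannZeta σ - 1 / ((σ : ℂ) - 1)) + 1 / ((σ : ℂ) - 1)‖ := by rw [sub_add_cancel]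
    _ ≤ ‖riemannZeta σ - 1 / ((σ : ℂ) - 1)‖ + ‖(1 : ℂ) / ((σ : ℂ) - 1)‖ := norm_add_le _ _
    _ ≤ C + 1 / (σ - 1) := by rw [hinv]; exact add_le_add h le_rfl
    _ ≤ 1 / (σ - 1) + max C 0 := by linarith [le_max_left C 0]

/-- `1 + k x ≤ (1 - x)^{-k}` for `0 ≤ x < 1`. [folklore] -/
theorem one_add_mul_le_inv_pow {x : ℝ} (h0 : 0 ≤ x) (h1 : x < 1) (k : ℕ) :
    1 + k * x ≤ ((1 - x)⁻¹) ^ k := by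
  have hx : 1 + x ≤ (1 - x)⁻¹ := by
    rw [← one_div, le_div_iff₀ (by linarith)]; nlinarith
  calc 1 + k * x ≤ (1 + x) ^ k := one_add_mul_le_pow (by linarith) k
    _ ≤ ((1 - x)⁻¹) ^ k := pow_le_pow_left₀ (by linarith) hx k

/-- **`∏_{p<n}(1 + k p^{-σ}) ≤ |ζ(σ)|^k ≤ (1/(σ-1) + C)^k`** for `1 < σ ≤ 2`: the bound behind
"`ζ(1 + 1/log R) = O(log R)`" in "Estimate (32)". [cite: ConlonFoxZhao2014, Section 9] -/
theorem exists_prod_one_add_mul_rpow_le : ∃ C : ℝ, 0 ≤ C ∧ ∀ (k : ℕ) (σ : ℝ), 1 < σ → σ ≤ 2 → ∀ n : ℕ,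
    ∏ p ∈ n.primesBelow, (1 + k * (p : ℝ) ^ (-σ)) ≤ (1 / (σ - 1) + C) ^ k := by
  obtain ⟨C, hC0, hC⟩ := exists_norm_zeta_real_le
  refine ⟨C, hC0, fun k σ h1 h2 n => ?_⟩
  have hfac : ∀ p ∈ n.primesBelow, 0 ≤ (p : ℝ) ^ (-σ) ∧ (p : ℝ) ^ (-σ) < 1 := fun p hp => by
    have hpP := (Nat.mem_primesBelow.1 hp).2
    have hp1 : (1 : ℝ) < p := by exact_mod_cast hpP.one_lt
    exact ⟨(Real.rpow_pos_of_pos (by linarith) _).le, Real.rpow_lt_one_of_one_lt_of_neg hp1 (by linarith)⟩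
  calc ∏ p ∈ n.primesBelow, (1 + k * (p : ℝ) ^ (-σ))
      ≤ ∏ p ∈ n.primesBelow, ((1 - (p : ℝ) ^ (-σ))⁻¹) ^ k :=
        prod_le_prod (fun p hp => by nlinarith [(hfac p hp).1]) fun p hp =>
          one_add_mul_le_inv_pow (hfac p hp).1 (hfac p hp).2 k
    _ = (∏ p ∈ n.primesBelow, (1 - (p : ℝ) ^ (-σ))⁻¹) ^ k := prod_pow _ _ _
    _ ≤ ‖riemannZeta σ‖ ^ k := by
        refine pow_le_pow_left₀ (prod_nonneg fun p hp => ?_) (prod_primesBelow_le_norm_zeta h1 n) k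
        exact inv_nonneg.2 (by linarith [(hfac p hp).2])
    _ ≤ (1 / (σ - 1) + C) ^ k := pow_le_pow_left₀ (norm_nonneg _) (hC σ h1 h2) k

/-- `∑_{i<n} 1/(i+1)² ≤ 2` (crude: `≤ π²/6`). [folklore] -/
theorem sum_range_one_div_succ_sq_le (n : ℕ) : ∑ i ∈ range n, (1 : ℝ) / ((i + 1 : ℕ) : ℝ) ^ 2 ≤ 2 := by
  have h := hasSum_zeta_two
  have hs : Summable fun i : ℕ => (1 : ℝ) / (i : ℝ) ^ 2 := h.summable
  have h1 : ∑ i ∈ range n, (1 : ℝ) / ((i + 1 : ℕ) : ℝ) ^ 2 ≤ ∑' i : ℕ, (1 : ℝ) / ((i + 1 : ℕ) : ℝ) ^ 2 := by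
    refine (hs.comp_injective (add_left_injective 1)).sum_le_tsum (range n) fun i _ => by positivity
  have h2 : ∑' i : ℕ, (1 : ℝ) / ((i + 1 : ℕ) : ℝ) ^ 2 ≤ ∑' i : ℕ, (1 : ℝ) / (i : ℝ) ^ 2 :=
    (hs.comp_injective (add_left_injective 1)).tsum_le_tsum_of_inj _ (add_left_injective 1)
      (fun i _ => by positivity) (fun i => le_rfl) hs
  have h3 : ∑' i : ℕ, (1 : ℝ) / (i : ℝ) ^ 2 = Real.pi ^ 2 / 6 := h.tsum_eq
  have hπ : Real.pi ^ 2 / 6 ≤ 2 := by nlinarith [Real.pi_lt_d2, Real.pi_pos]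
  linarith

/-- **`∏_{p<n}(1 + K/p²) ≤ exp(2K)`** for `K ≥ 0`. [folklore] -/
theorem prod_primesBelow_one_add_div_sq_le {K : ℝ} (hK : 0 ≤ K) (n : ℕ) :
    ∏ p ∈ n.primesBelow, (1 + K / (p : ℝ) ^ 2) ≤ Real.exp (2 * K) := by
  have h1 : ∏ p ∈ n.primesBelow, (1 + K / (p : ℝ) ^ 2) ≤ ∏ p ∈ n.primesBelow, Real.exp (K / (p : ℝ) ^ 2) :=
    prod_le_prod (fun p _ => by positivity) fun p _ => by linarith [Real.add_one_le_exp (K / (p : ℝ) ^ 2)]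
  refine h1.trans ?_
  rw [← Real.exp_sum, Real.exp_le_exp]
  -- `∑_{p<n prime} K/p² ≤ K ∑_{2 ≤ i < n} 1/i² ≤ 2K`
  have hsub : n.primesBelow ⊆ (range n).filter (fun i => 1 ≤ i) := fun p hp => by
    rw [mem_filter, mem_range]; exact ⟨(Nat.mem_primesBelow.1 hp).1, (Nat.mem_primesBelow.1 hp).2.one_lt.le⟩
  calc ∑ p ∈ n.primesBelow, K / (p : ℝ) ^ 2 ≤ ∑ i ∈ (range n).filter (fun i => 1 ≤ i), K / (i : ℝ) ^ 2 :=
        sum_le_sum_of_subset_of_nonneg hsub fun i _ _ => by positivity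
    _ = K * ∑ i ∈ (range n).filter (fun i => 1 ≤ i), 1 / (i : ℝ) ^ 2 := by
        rw [mul_sum]; exact sum_congr rfl fun i _ => by ring
    _ ≤ K * 2 := by
        gcongr
        -- reindex `i = j + 1`: the filtered range is the image of `range n` under `j ↦ j + 1`, cut at `n`
        have hsub' : (range n).filter (fun i => 1 ≤ i) ⊆ (range n).image (fun j : ℕ => j + 1) := fun i hi => by
          rw [mem_filter, mem_range] at hi
          rw [mem_image]; exact ⟨i - 1, by rw [mem_range]; omega, by omega⟩
        calc ∑ i ∈ (range n).filter (fun i => 1 ≤ i), (1 : ℝ) / (i : ℝ) ^ 2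
            ≤ ∑ i ∈ (range n).image (fun j : ℕ => j + 1), (1 : ℝ) / (i : ℝ) ^ 2 :=
              sum_le_sum_of_subset_of_nonneg hsub' fun i _ _ => by positivity
          _ = ∑ j ∈ range n, (1 : ℝ) / ((j + 1 : ℕ) : ℝ) ^ 2 := by
              rw [sum_image fun j _ j' _ h => Nat.add_right_cancel h]
          _ ≤ 2 := sum_range_one_div_succ_sq_le n
    _ = 2 * K := by ring

end Literature.NumberTheory.Sieve.CFZ
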